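import Summits.ResolutionOfSingularities.ResolutionOfSingularities.Theorems.EquisingularLiftEquisingularLiftBlowupModelFour
import Literature.AlgebraicGeometry.Resolution.ProjectiveBirationalBlowupProofs
import Literature.AlgebraicGeometry.Resolution.AlterationsBlowupDivisorProofs
import Literature.AlgebraicGeometry.Resolution.AlterationsResolution
import Literature.AlgebraicGeometry.Resolution.BlowupsExistence
import Literature.AlgebraicGeometry.Resolution.BlowupsIntegral
import Literature.AlgebraicGeometry.Resolution.BlowupsProperProofs
import HarnessLib

/-!
# Crux `EquisingularLift` (stmt-ResolutionOfSingularities-15660), line `Sketch` (skeleton v10c `f3e6993bf39ec5c9`):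
# DICTIONARY for the open residual `stub_blowupModel_ge_five` — «regular blow-up model» = «PROJECTIVE resolution»

[OURS · leafhand-res-equisingularlift-6 g1, 2026-08-31] AI-produced, weaker than expert review; NOT a statement of any
manuscript; nothing here proves resolution of singularities in positive characteristic, and NO registered stub is closed.

The open residual of the line is `stub_blowupModel_ge_five`: every integral closed `H ⊆ ℙⁿ_k` (`k = k̄` of characteristic
`p`, `n ≥ 5`) with locally principal ideal has a NON-ZERO ideal sheaf `𝔞` ALL of whose blow-ups (universal property,
`IsBlowup`) are regular.  The census words of record call this «= resolution of singularities in dimension `≥ 4` over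
algebraically closed fields (projective form)».  This file makes the dictionary a KERNEL THEOREM, for every field `k`, every
`n` and every integral closed subscheme `H ⊆ ℙⁿ_k` (no hypersurface hypothesis, no `k̄`, no `p`):

* `exists_projectiveResolution_of_blowupModel` — a regular blow-up model gives a resolution of singularities
  `π : Z → H` (`IsResolution`: proper, birational, regular source) whose source is PROJECTIVE over `k`
  (`IsProjectiveOver (Over.mk (π ≫ ι ≫ ℙⁿ_k → Spec k))`): the blow-up exists (`exists_isBlowup`, Görtz–Wedhorn 13.92,
  PROVED), is proper and birational with regular source (`IsBlowup.isResolution'`, Stacks 02NS + 02ND, both DISCHARGED),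
  and is projective over `k` (`IsBlowup.isProjectiveOver`, Hartshorne II 7.16 (c), DISCHARGED);
* `blowupModel_of_projectiveResolution` — conversely a resolution with projective source IS a blow-up along a non-zero
  ideal sheaf (Liu 2002 Thm. 8.1.24 = Hartshorne II.7.17, DISCHARGED as `Liu2002Thm8124Projective_holds`), and all blow-ups
  of that ideal are isomorphic to it (`IsBlowup.unique`), hence regular;
* `blowupModel_iff_projectiveResolution` — the dictionary as an `Iff`;
* `hasResolution_of_blowupModel` — forgetting projectivity: a regular blow-up model gives `Scheme.HasResolution H`;
* `blowupModels_ge_five_iff_projectiveResolutions_ge_five` — THE REGISTERED STUB `stub_blowupModel_ge_five` (its signature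
  verbatim on the left) is EQUIVALENT to «every integral closed `H ⊆ ℙⁿ_k̄`, `n ≥ 5`, char `p`, with locally principal
  ideal has a resolution of singularities with projective source»; `hasResolution_ge_five_of_blowupModels_ge_five` — and
  implies `HasResolution` for all of them (the summit's own predicate on that class).

Honest label: CALIBRATION of the open residual (both directions are theorems in print; the residual itself is the open
problem — barrier `DimensionFourFrontier`); `--supports stmt-ResolutionOfSingularities-15660 --as helper`, DEF-FREE,
standard axioms, zero named hypotheses.

References: [Liu2002, Thm. 8.1.24]; [Hartshorne1977, II.7.16 (c), II.7.17]; [GortzWedhorn2020, Prop. 13.92, 13.96];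
[StacksProject, Tags 02NS, 02ND, 02OS].
-/

set_option linter.dupNamespace false -- mandated namespace `Summit.<Summit>.<Problem>` of this single-conjunct summit

noncomputable section

open CategoryTheory CategoryTheory.Limits AlgebraicGeometry TopologicalSpace
open Literature.AlgebraicGeometry.Resolution Literature.AlgebraicGeometry.Motives

universe u

namespace Summit.ResolutionOfSingularities.ResolutionOfSingularities.Cruxes.EquisingularLift.StrataSplit

/-! ## The dictionary for one integral closed subscheme of `ℙⁿ_k` -/

/-- **A regular blow-up model gives a resolution of singularities with projective source.** For a field `k`, an integral
closed subscheme `ι : H ↪ ℙⁿ_k` and a non-zero ideal sheaf `𝔞` on `H` all of whose blow-ups are regular: the blow-up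
`π : Z → H` of `𝔞` exists (Görtz–Wedhorn 13.92), is a resolution of singularities (proper: Stacks 02NS; birational:
Stacks 02ND/02OS; regular by hypothesis) and `Z` is projective over `k` (Hartshorne II 7.16 (c)).
[cite: GortzWedhorn2020, Prop. 13.92] [cite: Hartshorne1977, II Prop. 7.16 (c)] [cite: StacksProject, Tag 02NS] -/
theorem exists_projectiveResolution_of_blowupModel {k : Type u} [Field k] {n : ℕ} {H : Scheme.{u}} [IsIntegral H]
    (ι : H ⟶ (projectiveSpace n k).left) [IsClosedImmersion ι]
    (h : ∃ 𝔞 : H.IdealSheafData, 𝔞 ≠ ⊥ ∧ ∀ (Z : Scheme.{u}) (π : Z ⟶ H), IsBlowup π 𝔞 → Scheme.IsRegular Z) :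
    ∃ (Z : Scheme.{u}) (π : Z ⟶ H), IsResolution π ∧
      IsProjectiveOver (Over.mk (π ≫ ι ≫ (projectiveSpace n k).hom)) := by
  obtain ⟨𝔞, h0, hreg⟩ := h
  haveI : IsProper (projectiveSpace n k).hom := isProper_projectiveSpace n k
  let f : H ⟶ Spec (.of k) := ι ≫ (projectiveSpace n k).hom
  have hHproj : IsProjectiveOver (Over.mk f) := ⟨n, Over.homMk ι rfl, ‹IsClosedImmersion ι›⟩
  haveI : IsProper f := inferInstance
  haveI : IsLocallyNoetherian H := LocallyOfFiniteType.isLocallyNoetherian f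
  obtain ⟨Z, π, hπ⟩ := exists_isBlowup H 𝔞
  exact ⟨Z, π, hπ.isResolution' stacks02NS_holds h0 (hreg Z π hπ), hπ.isProjectiveOver f hHproj⟩

/-- **A resolution of singularities with projective source is a regular blow-up model** (Liu 2002, Thm. 8.1.24 =
Hartshorne II.7.17, DISCHARGED in the tree as `Liu2002Thm8124Projective_holds`): for a field `k` and an integral closed
subscheme `ι : H ↪ ℙⁿ_k`, a resolution `π : Z → H` with `Z` projective over `k` (compatibly) is the blow-up of `H` along some
ideal sheaf `𝔞 ≠ ⊥` (`Z` is integral: reduced since regular, irreducible since birational to `H`), and every blow-up of `𝔞` is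
isomorphic to `Z` over `H` (`IsBlowup.unique`), hence regular. [cite: Liu2002, Thm. 8.1.24] [cite: Hartshorne1977, II.7.17] -/
theorem blowupModel_of_projectiveResolution {k : Type u} [Field k] {n : ℕ} {H : Scheme.{u}} [IsIntegral H]
    (ι : H ⟶ (projectiveSpace n k).left) [IsClosedImmersion ι]
    (h : ∃ (Z : Scheme.{u}) (π : Z ⟶ H), IsResolution π ∧
      IsProjectiveOver (Over.mk (π ≫ ι ≫ (projectiveSpace n k).hom))) :
    ∃ 𝔞 : H.IdealSheafData, 𝔞 ≠ ⊥ ∧ ∀ (Z : Scheme.{u}) (π : Z ⟶ H), IsBlowup π 𝔞 → Scheme.IsRegular Z := by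
  obtain ⟨Z, π, hres, hZproj⟩ := h
  haveI : IsProper (projectiveSpace n k).hom := isProper_projectiveSpace n k
  let f : H ⟶ Spec (.of k) := ι ≫ (projectiveSpace n k).hom
  have hHproj : IsProjectiveOver (Over.mk f) := ⟨n, Over.homMk ι rfl, ‹IsClosedImmersion ι›⟩
  haveI : IsReduced Z := hres.isRegular.isReduced
  haveI : IsIntegral Z := hres.isBirational.isIntegral
  obtain ⟨I, hI0, hI⟩ := Liu2002Thm8124Projective_holds k Z H π (π ≫ f) f inferInstance inferInstance
    hZproj hHproj rfl hres.isBirational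
  refine ⟨I, hI0, fun Z' π' hπ' => ?_⟩
  obtain ⟨e, -, -⟩ := hI.unique hπ'
  exact hres.isRegular.of_iso e.hom

/-- **THE DICTIONARY**: for a field `k` and an integral closed subscheme `ι : H ↪ ℙⁿ_k`, `H` has a non-zero ideal sheaf all of
whose blow-ups are regular **iff** `H` has a resolution of singularities whose source is projective over `k`.
[cite: Liu2002, Thm. 8.1.24] [cite: Hartshorne1977, II Prop. 7.16 (c), II.7.17] -/
theorem blowupModel_iff_projectiveResolution {k : Type u} [Field k] {n : ℕ} {H : Scheme.{u}} [IsIntegral H]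
    (ι : H ⟶ (projectiveSpace n k).left) [IsClosedImmersion ι] :
    (∃ 𝔞 : H.IdealSheafData, 𝔞 ≠ ⊥ ∧ ∀ (Z : Scheme.{u}) (π : Z ⟶ H), IsBlowup π 𝔞 → Scheme.IsRegular Z) ↔
      ∃ (Z : Scheme.{u}) (π : Z ⟶ H), IsResolution π ∧
        IsProjectiveOver (Over.mk (π ≫ ι ≫ (projectiveSpace n k).hom)) :=
  ⟨exists_projectiveResolution_of_blowupModel ι, blowupModel_of_projectiveResolution ι⟩

/-- **A regular blow-up model resolves** (projectivity forgotten): for a field `k` and an integral closed subscheme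
`ι : H ↪ ℙⁿ_k` with a non-zero ideal sheaf all of whose blow-ups are regular, `H` has a resolution of singularities
(`Scheme.HasResolution`, the summit's predicate). [cite: StacksProject, Tag 02NS] [cite: GortzWedhorn2020, Prop. 13.92] -/
theorem hasResolution_of_blowupModel {k : Type u} [Field k] {n : ℕ} {H : Scheme.{u}} [IsIntegral H]
    (ι : H ⟶ (projectiveSpace n k).left) [IsClosedImmersion ι]
    (h : ∃ 𝔞 : H.IdealSheafData, 𝔞 ≠ ⊥ ∧ ∀ (Z : Scheme.{u}) (π : Z ⟶ H), IsBlowup π 𝔞 → Scheme.IsRegular Z) :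
    Scheme.HasResolution H := by
  obtain ⟨Z, π, hres, -⟩ := exists_projectiveResolution_of_blowupModel ι h
  exact ⟨Z, π, hres⟩

/-! ## The registered open residual `stub_blowupModel_ge_five`, re-read through the dictionary -/

/-- **THE OPEN RESIDUAL OF THE LINE IS EXACTLY «PROJECTIVE RESOLUTION OF HYPERSURFACES OF DIMENSION `≥ 4` OVER `k̄`»**: the
registered signature of `stub_blowupModel_ge_five` (skeleton v10c `f3e6993bf39ec5c9`; left-hand side VERBATIM) is equivalent to:
for every prime `p`, every algebraically closed `k` of characteristic `p`, every `n ≥ 5` and every integral closed `H ⊆ ℙⁿ_k`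
with locally principal ideal, there is a resolution of singularities `π : Z → H` with `Z` projective over `k`. A calibration
of the residual (it stays OPEN: the right-hand side is the projective form of resolution of singularities in dimension `≥ 4`
over algebraically closed fields, barrier `DimensionFourFrontier`). [cite: Liu2002, Thm. 8.1.24] [cite: Hartshorne1977, II.7.17] -/
theorem blowupModels_ge_five_iff_projectiveResolutions_ge_five :
    (∀ p : ℕ, p.Prime → ∀ (k : Type) [Field k] [CharP k p] [IsAlgClosed k] (n : ℕ) (H : AlgebraicGeometry.Scheme.{0}) (ι : H ⟶ (Literature.AlgebraicGeometry.Motives.projectiveSpace n k).left), AlgebraicGeometry.IsClosedImmersion ι → AlgebraicGeometry.IsIntegral H → (∀ y : (Literature.AlgebraicGeometry.Motives.projectiveSpace n k).left, ∃ U : (Literature.AlgebraicGeometry.Motives.projectiveSpace n k).left.affineOpens, y ∈ (U : (Literature.AlgebraicGeometry.Motives.projectiveSpace n k).left.Opens) ∧ (ι.ker.ideal U).IsPrincipal) → 5 ≤ n → ∃ 𝔞 : H.IdealSheafData, 𝔞 ≠ ⊥ ∧ ∀ (Z : AlgebraicGeometry.Scheme.{0}) (π : Z ⟶ H), Literature.AlgebraicGeometry.Resolution.IsBlowup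 π 𝔞 → Literature.AlgebraicGeometry.Resolution.Scheme.IsRegular Z) ↔
    (∀ p : ℕ, p.Prime → ∀ (k : Type) [Field k] [CharP k p] [IsAlgClosed k] (n : ℕ) (H : AlgebraicGeometry.Scheme.{0}) (ι : H ⟶ (Literature.AlgebraicGeometry.Motives.projectiveSpace n k).left), AlgebraicGeometry.IsClosedImmersion ι → AlgebraicGeometry.IsIntegral H → (∀ y : (Literature.AlgebraicGeometry.Motives.projectiveSpace n k).left, ∃ U : (Literature.AlgebraicGeometry.Motives.projectiveSpace n k).left.affineOpens, y ∈ (U : (Literature.AlgebraicGeometry.Motives.projectiveSpace n k).left.Opens) ∧ (ι.ker.ideal U).IsPrincipal) → 5 ≤ n → ∃ (Z : AlgebraicGeometry.Scheme.{0}) (π : Z ⟶ H), Literature.AlgebraicGeometry.Resolution.IsResolution π ∧ Literature.AlgebraicGeometry.Motives.IsProjectiveOver (CategoryTheory.Over.mk (π ≫ ι ≫ (Literature.AlgebraicGeometry.Motives.projectiveSpace n k).hom))) := by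
  constructor
  · intro h p hp k _ _ _ n H ι hι hH hloc hn
    haveI := hι
    haveI := hH
    exact exists_projectiveResolution_of_blowupModel ι (h p hp k n H ι hι hH hloc hn)
  · intro h p hp k _ _ _ n H ι hι hH hloc hn
    haveI := hι
    haveI := hH
    exact blowupModel_of_projectiveResolution ι (h p hp k n H ι hι hH hloc hn)

/-- **The open residual implies resolution of singularities (`HasResolution`) of every integral closed `H ⊆ ℙⁿ_k̄` (`n ≥ 5`,
char `p`) with locally principal ideal** — the summit's own predicate on that class (strength certificate, lower bound of
the residual; cf. `hasResolution_hypersurface_of_equisingularLift` for the whole crux). [cite: StacksProject, Tag 02NS] -/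
theorem hasResolution_ge_five_of_blowupModels_ge_five
    (h5 : ∀ p : ℕ, p.Prime → ∀ (k : Type) [Field k] [CharP k p] [IsAlgClosed k] (n : ℕ) (H : AlgebraicGeometry.Scheme.{0}) (ι : H ⟶ (Literature.AlgebraicGeometry.Motives.projectiveSpace n k).left), AlgebraicGeometry.IsClosedImmersion ι → AlgebraicGeometry.IsIntegral H → (∀ y : (Literature.AlgebraicGeometry.Motives.projectiveSpace n k).left, ∃ U : (Literature.AlgebraicGeometry.Motives.projectiveSpace n k).left.affineOpens, y ∈ (U : (Literature.AlgebraicGeometry.Motives.projectiveSpace n k).left.Opens) ∧ (ι.ker.ideal U).IsPrincipal) → 5 ≤ n → ∃ 𝔞 : H.IdealSheafData, 𝔞 ≠ ⊥ ∧ ∀ (Z : AlgebraicGeometry.Scheme.{0}) (π : Z ⟶ H), Literature.AlgebraicGeometry.Resolution.IsBlowup π 𝔞 → Literature.AlgebraicGeometry.Resolution.Scheme.IsRegular Z) :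
    ∀ p : ℕ, p.Prime → ∀ (k : Type) [Field k] [CharP k p] [IsAlgClosed k] (n : ℕ) (H : AlgebraicGeometry.Scheme.{0}) (ι : H ⟶ (Literature.AlgebraicGeometry.Motives.projectiveSpace n k).left), AlgebraicGeometry.IsClosedImmersion ι → AlgebraicGeometry.IsIntegral H → (∀ y : (Literature.AlgebraicGeometry.Motives.projectiveSpace n k).left, ∃ U : (Literature.AlgebraicGeometry.Motives.projectiveSpace n k).left.affineOpens, y ∈ (U : (Literature.AlgebraicGeometry.Motives.projectiveSpace n k).left.Opens) ∧ (ι.ker.ideal U).IsPrincipal) → 5 ≤ n → Literature.AlgebraicGeometry.Resolution.Scheme.HasResolution H := by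
  intro p hp k _ _ _ n H ι hι hH hloc hn
  haveI := hι
  haveI := hH
  exact hasResolution_of_blowupModel ι (h5 p hp k n H ι hι hH hloc hn)

end Summit.ResolutionOfSingularities.ResolutionOfSingularities.Cruxes.EquisingularLift.StrataSplit

end
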